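import Summits.QuantumFields.YangMills.Theorems.QuantileBitPuritySU2ClassShiftRay
import Summits.QuantumFields.YangMills.Theorems.FemtoTransferGapRungW1upAlgebra
import HarnessLib

/-!
# The own-axis class shift is conjugation covariant: `classShift θ (g W g⁻¹) = g (classShift θ W) g⁻¹`

Support module (`--supports` stmt-QuantumFields-23948; memo HOME `bc/g14-dw/PLAN-PERIODIC.md` §B–§C).  The sheet shift of the translate lines reads its
element COVARIANTLY from a holonomy (`h(s) = exp(θ · axis(P(s)))`); under a gauge transformation the holonomy is conjugated, `P ↦ g P g⁻¹`, and the
shift element must follow, `h ↦ g h g⁻¹` — this is what makes `(shift U)^g = shift (U^g)` and hence the seam of the UNTWISTED sector exact.  Here the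
one-group statement: the axis rotates (`ι(axisVec (gWg⁻¹)) = q_g · ι(axisVec W) · q_g⁻¹` in the quaternion model; `ι ∘ imVec = Im` as in the tree's
`T4ExpWindowSmallField.imQuat_imVec`, `Re` is conjugation invariant as in `BPST.re_conj`) and the quaternion exponential is
conjugation covariant (Mathlib `NormedSpace.exp_conj`), so ★ `classShift_conj`: `classShift θ (g * W * g⁻¹) = g * classShift θ W * g⁻¹`.
§2 is the dictionary between the exponential chart and the tree's distance to the centre: `Re tr exp(ι y) = 2 cos ‖y‖`, `vacDist W² = 4 − 2|Re tr W|`,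
`vacDist (exp(ι y))² = 4 − 4|cos ‖y‖|` — so events `{vacDist ∈ [c₁, c₂]}` (cores, strips of `polDist`) are exponential-chart shells.
HONEST FRAMING: algebra on one compact group; nothing about lattice gauge theory, infinite volume, the continuum limit or the Clay gap.  No `sorry`, no new
axiom, no new definition.  References: [folklore].
-/

set_option autoImplicit false

noncomputable section

open Set Function NormedSpace
open scoped Real Quaternion

namespace Summit.QuantumFields.YangMills.Theorems.FemtoTransferGap.ClassShift

open Literature.MathematicalPhysics.QuantumLattice (su2Quat quatToSU2 quatToSU2_su2Quat su2Quat_ne_zero norm_su2Quat trace_quatToSU2_re)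
open Literature.MathematicalPhysics.QuantumFieldTheory (frobNorm frobNorm_nonneg)
open Literature.MathematicalPhysics.QuantumFieldTheory.Balaban1983to89.T4HaarSU2ExpChart
open Literature.MathematicalPhysics.QuantumFieldTheory.Balaban1983to89.T4HaarSU2Translate (su2Quat_mul su2Quat_one)
open Summit.QuantumFields.YangMills.Theorems.WeakCouplingRates (quatToSU2_mul_quatToSU2)

/-- `ℍ` has characteristic zero (it contains `ℝ`). [folklore] -/
theorem charZero_quaternion : CharZero ℍ := charZero_of_injective_ringHom (algebraMap ℝ ℍ).injective

/-- `‖imVec q‖ = ‖Im q‖`. [folklore] -/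
theorem norm_imVec (q : ℍ) : ‖imVec q‖ = ‖q.im‖ := by
  have himv : imQuat (imVec q) = q.im := by ext <;> simp [imQuat_apply, imVec, Quaternion.im]
  rw [← norm_imQuat, himv]

/-- `su2Quat` of an inverse is the inverse quaternion. [folklore] -/
theorem su2Quat_inv (g : Matrix.specialUnitaryGroup (Fin 2) ℂ) : su2Quat g⁻¹ = (su2Quat g)⁻¹ := by
  have h : su2Quat g * su2Quat g⁻¹ = 1 := by rw [← su2Quat_mul, mul_inv_cancel, su2Quat_one]
  exact (eq_inv_of_mul_eq_one_right h)

/-- **The imaginary part conjugates**: `Im(p q p⁻¹) = p · Im q · p⁻¹` (`p ≠ 0`). [folklore] -/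
theorem im_conj_quat {p : ℍ} (hp : p ≠ 0) (q : ℍ) : (p * q * p⁻¹).im = p * q.im * p⁻¹ := by
  -- conjugation preserves real parts (tree: `Literature.Geometry.GaugeTheory.BPST.re_conj`; re-derived in two lines to keep the import light)
  have re_conj_quat : ∀ x : ℍ, (p * x * p⁻¹).re = x.re := fun x => by
    have h1 : (p * x * p⁻¹).re = (x * p⁻¹ * p).re := by
      rw [mul_assoc]
      have : ∀ a b : ℍ, (a * b).re = (b * a).re := fun a b => by rw [Quaternion.re_mul, Quaternion.re_mul]; ring
      exact this _ _
    rw [h1, mul_assoc, inv_mul_cancel₀ hp, mul_one]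
  have hdec : p * q * p⁻¹ = ((q.re : ℝ) : ℍ) + p * q.im * p⁻¹ := by
    conv_lhs => rw [← Quaternion.re_add_im q]
    rw [mul_add, add_mul, show p * (q.re : ℍ) * p⁻¹ = (q.re : ℍ) by
      rw [← Quaternion.coe_commutes, mul_assoc, mul_inv_cancel₀ hp, mul_one]]
  rw [← Quaternion.sub_re_self (p * q * p⁻¹), re_conj_quat, hdec, add_sub_cancel_left]

/-- `‖p y p⁻¹‖ = ‖y‖` for a unit quaternion `p`. [folklore] -/
theorem norm_conj_quat {p : ℍ} (hp : ‖p‖ = 1) (y : ℍ) : ‖p * y * p⁻¹‖ = ‖y‖ := by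
  rw [norm_mul, norm_mul, norm_inv, hp, one_mul, inv_one, mul_one]

/-- **The axis rotates**: `ι(axisVec (g W g⁻¹)) = q_g · ι(axisVec W) · q_g⁻¹`. [folklore] -/
theorem imQuat_axisVec_conj (g W : Matrix.specialUnitaryGroup (Fin 2) ℂ) :
    imQuat (axisVec (g * W * g⁻¹)) = su2Quat g * imQuat (axisVec W) * (su2Quat g)⁻¹ := by
  have hp := su2Quat_ne_zero g
  have himv : ∀ q : ℍ, imQuat (imVec q) = q.im := fun q => by ext <;> simp [imQuat_apply, imVec, Quaternion.im]
  unfold axisVec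
  rw [map_smul, map_smul, himv, himv, norm_imVec, norm_imVec, su2Quat_mul, su2Quat_mul, su2Quat_inv,
    im_conj_quat hp, norm_conj_quat (norm_su2Quat g)]
  rw [mul_smul_comm, smul_mul_assoc]

/-- ★ **Conjugation covariance of the own-axis shift**: `classShift θ (g W g⁻¹) = g · classShift θ W · g⁻¹`. [folklore] -/
theorem classShift_conj (θ : ℝ) (g W : Matrix.specialUnitaryGroup (Fin 2) ℂ) :
    classShift θ (g * W * g⁻¹) = g * classShift θ W * g⁻¹ := by
  haveI : CharZero ℍ := charZero_quaternion
  have hp := su2Quat_ne_zero g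
  have hne : ∀ y : EuclideanSpace ℝ (Fin 3), exp (imQuat y) ≠ (0 : ℍ) := fun y h => by
    have := norm_exp_imQuat y; rw [h, norm_zero] at this; exact zero_ne_one this
  -- the shift element conjugates
  have hE : expPoint (θ • axisVec (g * W * g⁻¹)) = g * expPoint (θ • axisVec W) * g⁻¹ := by
    have h1 : imQuat (θ • axisVec (g * W * g⁻¹)) = su2Quat g * imQuat (θ • axisVec W) * (su2Quat g)⁻¹ := by
      rw [map_smul, map_smul, imQuat_axisVec_conj, mul_smul_comm, smul_mul_assoc]
    unfold expPoint
    rw [h1, exp_conj _ _ hp, ← quatToSU2_mul_quatToSU2 (mul_ne_zero hp (hne _)) (inv_ne_zero hp),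
      ← quatToSU2_mul_quatToSU2 hp (hne _), ← su2Quat_inv, quatToSU2_su2Quat, quatToSU2_su2Quat]
  rw [classShift_apply, classShift_apply, hE]
  group

/-! ## §2 Dictionary: the exponential chart and the distance to the centre -/

/-- `Re tr exp(ι y) = 2 cos ‖y‖`. [folklore] -/
theorem re_trace_expPoint (y : EuclideanSpace ℝ (Fin 3)) :
    ((expPoint y : Matrix (Fin 2) (Fin 2) ℂ).trace).re = 2 * Real.cos ‖y‖ := by
  have hne : exp (imQuat y) ≠ (0 : ℍ) := fun h => by
    have := norm_exp_imQuat y; rw [h, norm_zero] at this; exact zero_ne_one this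
  unfold expPoint
  rw [trace_quatToSU2_re hne, norm_exp_imQuat, exp_imQuat_re, inv_one, one_mul]

/-- `vacDist W² = 4 − 2|Re tr W|` on `SU(2)` (`‖W ∓ 1‖_F² = 4 ∓ 2 Re tr W`). [folklore] -/
theorem vacDist_sq_eq (W : SU2) : vacDist W ^ 2 = 4 - 2 * |((W : Matrix (Fin 2) (Fin 2) ℂ).trace).re| := by
  have hm : frobNorm ((W : Matrix (Fin 2) (Fin 2) ℂ) - 1) ^ 2 = 4 - 2 * ((W : Matrix (Fin 2) (Fin 2) ℂ).trace).re := by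
    have h := two_sub_re_trace_eq W; linarith
  have hp : frobNorm ((W : Matrix (Fin 2) (Fin 2) ℂ) + 1) ^ 2 = 4 + 2 * ((W : Matrix (Fin 2) (Fin 2) ℂ).trace).re := by
    rw [frobNorm_add_one_sq_eq, hm]; ring
  have hm0 := frobNorm_nonneg ((W : Matrix (Fin 2) (Fin 2) ℂ) - 1)
  have hp0 := frobNorm_nonneg ((W : Matrix (Fin 2) (Fin 2) ℂ) + 1)
  unfold vacDist
  by_cases ht : 0 ≤ ((W : Matrix (Fin 2) (Fin 2) ℂ).trace).re
  · rw [abs_of_nonneg ht, min_eq_left, hm]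
    exact (pow_le_pow_iff_left₀ hm0 hp0 two_ne_zero).1 (by rw [hm, hp]; linarith)
  · rw [not_le] at ht
    rw [abs_of_neg ht, min_eq_right, hp]
    · ring
    exact (pow_le_pow_iff_left₀ hp0 hm0 two_ne_zero).1 (by rw [hm, hp]; linarith)

/-- ★ **The distance to the centre in the exponential chart**: `vacDist (exp(ι y))² = 4 − 4|cos ‖y‖|` — the core `{vacDist ≤ c}` and the strips
`{|vacDist − c| ≤ w}` are exponential-chart shells in `‖y‖` (mod the reflection `r ↦ π − r`). [folklore] -/
theorem vacDist_expPoint_sq (y : EuclideanSpace ℝ (Fin 3)) : vacDist (expPoint y) ^ 2 = 4 - 4 * |Real.cos ‖y‖| := by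
  rw [vacDist_sq_eq, re_trace_expPoint, abs_mul, abs_of_pos (by norm_num : (0 : ℝ) < 2)]
  ring

end Summit.QuantumFields.YangMills.Theorems.FemtoTransferGap.ClassShift

end
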